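import Summits.SmoothPoincare4.SmoothPoincare4.Theorems.SymplecticOrigamiGromovRecognitionRelEndHelperUniformLimitIsJSphere

/-!
# Split piece `GromovCompactnessSpheres` (crux stmt-SmoothPoincare4-16777): the birth stub
`stub_uniformLimitIsJSphere` is PROVED

The birth skeleton `Cruxes/GromovRecognitionRelEnd/SplitCompactnessBirth.lean` of the split piece
`GromovCompactnessSpheres` (Gromov compactness for `J`-spheres, dichotomy form; McDuff–Salamon 2012
Thm. 5.3.1) registered two stubs on item stmt-SmoothPoincare4-16777.  This file proves the second one,
`stub_uniformLimitIsJSphere` (uniform limits of glued maps of `J`-holomorphic two-chart spheres are glued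
maps of smooth `J`-holomorphic two-chart spheres; Hummel 1997, Ch. III Prop. 3.1 / McDuff–Salamon 2012
§4.6), VERBATIM, by the registered helper `helper_uniformLimitIsJSphere` of the parent crux's line
`cross-cap-laurent` (`…HelperUniformLimitIsJSphere.lean`, lead c6 of stmt-SmoothPoincare4-11009): the two
charts of the limit are read through the affine charts of `ℂℙ¹`, and the manifold form of the generalized
Weierstraß theorem (`helper_jHolomorphicOfCompactOpenLimit`, over the tree's proved flat theorem
`JHolomorphicWeierstrassR4_holds`) makes them smooth and `J`-holomorphic.

What remains open in the piece is the bubbling stub `stub_bubblingOrUniformLimit` (XL).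

References: C. Hummel, *Gromov's Compactness Theorem for Pseudo-holomorphic Curves* (1997), Ch. III
Prop. 3.1; D. McDuff, D. Salamon, *J-holomorphic curves and symplectic topology*, 2nd ed. (2012),
Thm. 4.1.1, §4.6, Thm. 5.3.1.  No new definitions, notation or instances.
-/

open scoped Manifold ContDiff Topology
open Set Function Filter
open Literature.Topology.FourManifolds Literature.Topology.FourManifolds.ComplexProjectiveSpace
open Literature.Geometry.Symplectic Literature.Geometry.Kaehler

-- the prescribed namespace `Summit.<P>.<Sub>.…` duplicates `SmoothPoincare4` (P = Sub)
set_option linter.dupNamespace false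

namespace Summit.SmoothPoincare4.SmoothPoincare4.Theorems.GromovCompactnessSpheres

/-- **Birth stub `stub_uniformLimitIsJSphere` of the split piece `GromovCompactnessSpheres`
(stmt-SmoothPoincare4-16777), proved:** a uniform limit `F : C(ℂℙ¹, X)` of glued maps of smooth
`J`-holomorphic two-chart spheres is the glued map of a smooth `J`-holomorphic two-chart sphere
(the registered helper `helper_uniformLimitIsJSphere` of line `cross-cap-laurent` of the parent crux
`GromovRecognitionRelEnd`). [cite: Hummel1997, Ch. III Prop. 3.1] -/
theorem stub_uniformLimitIsJSphere : ∀ (X : Type) [TopologicalSpace X] [T2Space X] [SecondCountableTopology X] [CompactSpace X] [ChartedSpace (EuclideanSpace ℝ (Fin 4)) X] [IsManifold (𝓡 4) ∞ X] (ωX : MForm (𝓡 4) X ℝ 2) (JX : AlmostComplexStructure (𝓡 4) ∞ X) (Gs : ℕ → C(ComplexProjectiveSpace 1, X)) (F₀ F : C(ComplexProjectiveSpace 1, X)), IsSmoothForm ωX → IsClosedForm ωX → JX.IsTamedBy ωX → (∀ k, (∃ (u v : ℂ → X), ContMDiff 𝓘(ℝ, ℂ) (𝓡 4) ∞ u ∧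 ContMDiff 𝓘(ℝ, ℂ) (𝓡 4) ∞ v ∧ (∀ z : ℂ, z ≠ 0 → v z = u z⁻¹) ∧ IsJHolomorphic (𝓡 4) (fun y => JX y) u ∧ IsJHolomorphic (𝓡 4) (fun y => JX y) v ∧ (∀ p, CoordNeZero 0 p → Gs k p = u (affineCoordComplex 0 p 0)) ∧ (∀ p, CoordNeZero 1 p → Gs k p = v (affineCoordComplex 1 p 0))) ∧ (Gs k).Homotopic F₀) → Filter.Tendsto Gs Filter.atTop (𝓝 F) → ∃ (u v : ℂ → X), ContMDiff 𝓘(ℝ, ℂ) (𝓡 4) ∞ u ∧ ContMDiff 𝓘(ℝ, ℂ) (𝓡 4) ∞ v ∧ (∀ z : ℂ, z ≠ 0 → v z = u z⁻¹) ∧ IsJHolomorphic (𝓡 4) (fun y => JX y) u ∧ IsJHolomorphic (𝓡 4) (fun y => JX y) v ∧ (∀ p, CoordNeZero 0 p → F p = u (affineCoordComplex 0 p 0)) ∧ (∀ p, CoordNeZero 1 p → F p = v (affineCoordComplex 1 p 0)) :=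
  Summit.SmoothPoincare4.SmoothPoincare4.Theorems.GromovRecognitionRelEnd.CrossCapLaurent.helper_uniformLimitIsJSphere

end Summit.SmoothPoincare4.SmoothPoincare4.Theorems.GromovCompactnessSpheres
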